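/-
COR-CM (cell pub-hodgecm2, stage 2 of the Hodge ladder) — count-neutral, INTRINSIC (generator) form of the degree-14 census
transport (seat prover-pub-hodgecm2-b23-g35-0, binder prover b23, gen 35; claim DEG14-TRANSPORT = seat lit-andre-3ʼs sized ask
A6-R37; sequel of `Census/TetradecicFaceTransportCyclic.lean` and `CorCM/FaceCensusGroupDictionary.lean`, pattern of
`Census/CyclicFaceTransportIntrinsic.lean` (ℤ/8, ℤ/10, ℤ/12)). Theorems only: the dictionary binders (`ε`, `hε`, `ε c = Γ.conj`)
of the automorphism form are DERIVED from ONE generator of `Aut(K)` and `finrank ℚ K = 14`; the nine faces are read as `g`-power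
data; the closed field-closure theorem follows. No definition, no named fact, nothing asserted; `Interfaces.lean` (C1), every E
term, B01 and `Transposition/*` are untouched. HONEST FRAMING (COORDINATOR RULING — HODGE FRAMING CORRECTION,
2026-08-21T11:55:35Z): `HC_CM` is NOT proved, here or anywhere in the tree; the headline is CONDITIONAL on nine face periods for
ONE field.
T5 (coordinator ruling 15:33:56Z (3)): binder set of the headline = {`finrank ℚ K = 14` + a generator `g` of `Aut(K)` (inhabited by
every cyclic tetradecic CM field), nine face descriptions (inhabited: `exists_face_of_generator_*`), nine face periods = instances of the
crux (`FacePeriodExists` / B01-S) with no `¬` theorem in the tree on the universe of record} — no contradiction derivable; checker: self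
(prover-pub-hodgecm2-b23-g35-0), 2026-08-22.
-/
import Summits.HodgeConjecture.CorCM.FaceCensusGroupDictionary
import Summits.HodgeConjecture.CorCM.Census.TetradecicFaceTransportCyclic
import HarnessLib

/-!
# Degree 14, cyclic type `ℤ/14`: the field closure from ONE generator and nine face periods (intrinsic form)

What a field seat supplies NOW for a cyclic CM field `K` of degree 14: `hK : finrank ℚ K = 14`, a generator `g` of `K ≃ₐ[ℚ] K` (`∀
x, x ∈ Subgroup.zpowers g`), a base embedding `σ₀`, the nine faces described by `g`-powers (base type by its exponent set, place
representatives `σ₀ ∘ g ^ a`, `σ₀ ∘ g ^ b`), and ONE period witness per face on the universe of record. Complex conjugation at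
`σ₀` is `g ^ 7` automatically (the unique involution), so no conjugation hypothesis appears. Output: the Hodge conjecture for
every complex abelian variety dominated by a finite product of CM abelian varieties with CM types of subfields of `K`. `HC_CM` is
NOT proved; nothing here produces a period.

References: [cite: Pohlmann1968, Thm. 1]; [cite: Milne1999LefschetzClasses, Thm. 3.2 and Cor. 4.5];
[cite: Shimura1998, §6.2 Theorem 3 and §6.1 Corollary of Theorem 2 (pp. 41–43)]; [cite: MumfordAV1970, §19 Thm. 1 and p. 169].
-/

noncomputable section

open CategoryTheory NumberField NumberField.ComplexEmbedding
open Literature.AlgebraicGeometry Literature.AlgebraicGeometry.Motives Literature.AlgebraicGeometry.HodgeTheory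
open Literature.AlgebraicGeometry.ComplexMultiplication Literature.AlgebraicGeometry.Milne1999
open Literature.NumberTheory.Automorphic
open Literature.NumberTheory.Automorphic.PicardCM
open Summit.HodgeConjecture.CorCM.Domination

namespace Summit.HodgeConjecture.CorCM.TetradecicFaceTransport.Cyclic

open Summit.HodgeConjecture.CorCM.Census.FaceSquaresModel (mem)
open Summit.HodgeConjecture.CorCM.Census.TetradecicFaceGeneratorsCyclic (Γ enum group_spec)

/-- `ZMod 14`: the only non-zero element killed by `2` is `7`. [folklore] -/
theorem zmod_fourteen_involution : ∀ x : ZMod 14, x ≠ 0 → x + x = 0 → x = 7 := by decide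

/-- **The dictionary from ONE generator, type `ℤ/14` (cyclic tetradecic; `c = 7`).**  `K` a Galois CM field of degree `14` whose
Galois group is generated by `g`; `σ₀` any base embedding.  Then there is an enumeration `ε : Aut(K) ≃ Fin 14`, multiplicative for the
census table, reading `g ^ k ↦ k`, under which THE automorphism inducing complex conjugation at `σ₀` reads `Γ.conj = 7` — proved, not
assumed: it is the unique involution `g ^ 7` (`FaceCensus.exists_enum_of_generator`, `zmod_fourteen_involution`). [folklore] -/
theorem exists_autEnum_of_generator (K : CMField) [IsGalois ℚ K] (hK : Module.finrank ℚ (K : Type) = 14)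
    {g : ((K : Type) ≃ₐ[ℚ] (K : Type))} (hg : ∀ x, x ∈ Subgroup.zpowers g) (σ₀ : (K : Type) →+* ℂ) :
    ∃ ε : ((K : Type) ≃ₐ[ℚ] (K : Type)) ≃ Fin 14,
      (∀ x y : ((K : Type) ≃ₐ[ℚ] (K : Type)), ε (x * y) = Γ.mul (ε x) (ε y)) ∧ (∀ k : Fin 14, ε (g ^ (k : ℕ)) = k) ∧
      ∀ c : ((K : Type) ≃ₐ[ℚ] (K : Type)), σ₀.comp (c : (K : Type) →+* (K : Type)) = conjugate σ₀ → ε c = Γ.conj := by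
  have hn : Nat.card ((K : Type) ≃ₐ[ℚ] (K : Type)) = 14 := (IsGalois.card_aut_eq_finrank ℚ (K : Type)).trans hK
  obtain ⟨ε, hε, hread, hinv⟩ := FaceCensus.exists_enum_of_generator Γ enum group_spec.2.1 group_spec.2.2.1 hg hn
  refine ⟨ε, hε, fun k => FaceCensus.enum_pow_eq ε hread k, fun c hc => group_spec.2.2.1 ?_⟩
  obtain ⟨h0, h2⟩ := hinv c (FaceCensus.conjAut_mul_self σ₀ hc) (FaceCensus.conjAut_ne_one σ₀ hc)
  rw [group_spec.2.2.2]
  exact zmod_fourteen_involution _ h0 h2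

/-- The base type of code `127` is the «`g`-interval» `{k | k < 7}` (lit-andre-3ʼs block `B₀`). [folklore] -/
theorem mem_127_iff : ∀ k : Fin 14, mem k 127 = true ↔ (k : ℕ) < 7 := by decide

/-- The base type of code `381` is the set `{0, 2, 3, 4, 5, 6, 8}` of exponents (a translate of lit-andre-3ʼs block `B₅`). [folklore] -/
theorem mem_381_iff : ∀ k : Fin 14, mem k 381 = true ↔ k ∈ ({0, 2, 3, 4, 5, 6, 8} : Finset (Fin 14)) := by decide

/-- The base type of code `5461` is the EVEN exponents (the type of the CM elliptic curve `E` of the imaginary quadratic subfield, induced to `K`). [folklore] -/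
theorem mem_5461_iff : ∀ k : Fin 14, mem k 5461 = true ↔ (k : ℕ) % 2 = 0 := by decide

/-- **Faces on the type of code `127` exist (non-vacuity), type `ℤ/14`.**  For `K`, `g`, `σ₀` as above there is a CM type `Φ₀` of `K`
reading as the «`g`-interval» `{k | k < 7}` (lit-andre-3ʼs block `B₀`) — `σ₀ ∘ g ^ k ∈ Φ₀ ↔` that condition on `k` (`0 ≤ k < 14`) — and for any two exponents `a, b` at different
places (`b ≠ a`, `b ≠ a + 7`) a rank-four face `(Φ₀; σ₀ ∘ g ^ a, σ₀ ∘ g ^ b)` with exactly these place representatives. [folklore] -/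
theorem exists_face_of_generator_127 (K : CMField) [IsGalois ℚ K] (hK : Module.finrank ℚ (K : Type) = 14)
    {g : ((K : Type) ≃ₐ[ℚ] (K : Type))} (hg : ∀ x, x ∈ Subgroup.zpowers g) (σ₀ : (K : Type) →+* ℂ) (a b : Fin 14)
    (hab : a ≠ b ∧ Γ.mul Γ.conj a ≠ b) :
    ∃ R : Face K, (∀ k : Fin 14, σ₀.comp ((g ^ (k : ℕ) : ((K : Type) ≃ₐ[ℚ] (K : Type))) : (K : Type) →+* (K : Type)) ∈ R.Φ.1 ↔ (k : ℕ) < 7) ∧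
      R.p = σ₀.comp ((g ^ (a : ℕ) : ((K : Type) ≃ₐ[ℚ] (K : Type))) : (K : Type) →+* (K : Type)) ∧ R.p' = σ₀.comp ((g ^ (b : ℕ) : ((K : Type) ≃ₐ[ℚ] (K : Type))) : (K : Type) →+* (K : Type)) := by
  obtain ⟨ε, hε, hpow, hconj⟩ := exists_autEnum_of_generator K hK hg σ₀
  obtain ⟨c, hc⟩ := FaceCensus.exists_conjAut σ₀
  obtain ⟨e, hmul, he⟩ := FaceCensus.exists_enum_of_autEnum Γ σ₀ ε hε
  have hconj' : e conjT = Γ.conj := by rw [FaceCensus.conjT_eq_translate σ₀, ← hc, he, hconj c hc]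
  obtain ⟨R₀, hT₀, -, -⟩ := FaceCensus.exists_face_reads Γ e hmul hconj' σ₀ (r := (127, 129, 258)) (by decide +kernel)
  have hne : InfinitePlace.mk (σ₀.comp ((g ^ (a : ℕ) : ((K : Type) ≃ₐ[ℚ] (K : Type))) : (K : Type) →+* (K : Type))) ≠ InfinitePlace.mk (σ₀.comp ((g ^ (b : ℕ) : ((K : Type) ≃ₐ[ℚ] (K : Type))) : (K : Type) →+* (K : Type))) := by
    rw [Ne, FaceCensus.mk_comp_eq_mk_comp_iff σ₀ hc]
    rintro (h | h)
    · exact hab.1 (by rw [← hpow a, ← hpow b, h])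
    · exact hab.2 (by rw [← hpow a, ← hpow b, ← h, hε, hconj c hc])
  refine ⟨⟨R₀.Φ, _, _, hne⟩, fun k => ?_, rfl, rfl⟩
  have hk := hT₀.2 (e (translate σ₀ (σ₀.comp ((g ^ (k : ℕ) : ((K : Type) ≃ₐ[ℚ] (K : Type))) : (K : Type) →+* (K : Type)))))
  rw [e.symm_apply_apply, mem_pullType, translate_apply_self, he, hpow] at hk
  exact hk.symm.trans (mem_127_iff k)

/-- **Faces on the type of code `381` exist (non-vacuity), type `ℤ/14`.**  For `K`, `g`, `σ₀` as above there is a CM type `Φ₀` of `K`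
reading as the set `{0, 2, 3, 4, 5, 6, 8}` of exponents (a translate of lit-andre-3ʼs block `B₅`) — `σ₀ ∘ g ^ k ∈ Φ₀ ↔` that condition on `k` (`0 ≤ k < 14`) — and for any two exponents `a, b` at different
places (`b ≠ a`, `b ≠ a + 7`) a rank-four face `(Φ₀; σ₀ ∘ g ^ a, σ₀ ∘ g ^ b)` with exactly these place representatives. [folklore] -/
theorem exists_face_of_generator_381 (K : CMField) [IsGalois ℚ K] (hK : Module.finrank ℚ (K : Type) = 14)
    {g : ((K : Type) ≃ₐ[ℚ] (K : Type))} (hg : ∀ x, x ∈ Subgroup.zpowers g) (σ₀ : (K : Type) →+* ℂ) (a b : Fin 14)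
    (hab : a ≠ b ∧ Γ.mul Γ.conj a ≠ b) :
    ∃ R : Face K, (∀ k : Fin 14, σ₀.comp ((g ^ (k : ℕ) : ((K : Type) ≃ₐ[ℚ] (K : Type))) : (K : Type) →+* (K : Type)) ∈ R.Φ.1 ↔ k ∈ ({0, 2, 3, 4, 5, 6, 8} : Finset (Fin 14))) ∧
      R.p = σ₀.comp ((g ^ (a : ℕ) : ((K : Type) ≃ₐ[ℚ] (K : Type))) : (K : Type) →+* (K : Type)) ∧ R.p' = σ₀.comp ((g ^ (b : ℕ) : ((K : Type) ≃ₐ[ℚ] (K : Type))) : (K : Type) →+* (K : Type)) := by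
  obtain ⟨ε, hε, hpow, hconj⟩ := exists_autEnum_of_generator K hK hg σ₀
  obtain ⟨c, hc⟩ := FaceCensus.exists_conjAut σ₀
  obtain ⟨e, hmul, he⟩ := FaceCensus.exists_enum_of_autEnum Γ σ₀ ε hε
  have hconj' : e conjT = Γ.conj := by rw [FaceCensus.conjT_eq_translate σ₀, ← hc, he, hconj c hc]
  obtain ⟨R₀, hT₀, -, -⟩ := FaceCensus.exists_face_reads Γ e hmul hconj' σ₀ (r := (381, 516, 8256)) (by decide +kernel)
  have hne : InfinitePlace.mk (σ₀.comp ((g ^ (a : ℕ) : ((K : Type) ≃ₐ[ℚ] (K : Type))) : (K : Type) →+* (K : Type))) ≠ InfinitePlace.mk (σ₀.comp ((g ^ (b : ℕ) : ((K : Type) ≃ₐ[ℚ] (K : Type))) : (K : Type) →+* (K : Type))) := by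
    rw [Ne, FaceCensus.mk_comp_eq_mk_comp_iff σ₀ hc]
    rintro (h | h)
    · exact hab.1 (by rw [← hpow a, ← hpow b, h])
    · exact hab.2 (by rw [← hpow a, ← hpow b, ← h, hε, hconj c hc])
  refine ⟨⟨R₀.Φ, _, _, hne⟩, fun k => ?_, rfl, rfl⟩
  have hk := hT₀.2 (e (translate σ₀ (σ₀.comp ((g ^ (k : ℕ) : ((K : Type) ≃ₐ[ℚ] (K : Type))) : (K : Type) →+* (K : Type)))))
  rw [e.symm_apply_apply, mem_pullType, translate_apply_self, he, hpow] at hk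
  exact hk.symm.trans (mem_381_iff k)

/-- **Faces on the type of code `5461` exist (non-vacuity), type `ℤ/14`.**  For `K`, `g`, `σ₀` as above there is a CM type `Φ₀` of `K`
reading as the EVEN exponents (the type of the CM elliptic curve `E` of the imaginary quadratic subfield, induced to `K`) — `σ₀ ∘ g ^ k ∈ Φ₀ ↔` that condition on `k` (`0 ≤ k < 14`) — and for any two exponents `a, b` at different
places (`b ≠ a`, `b ≠ a + 7`) a rank-four face `(Φ₀; σ₀ ∘ g ^ a, σ₀ ∘ g ^ b)` with exactly these place representatives. [folklore] -/
theorem exists_face_of_generator_5461 (K : CMField) [IsGalois ℚ K] (hK : Module.finrank ℚ (K : Type) = 14)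
    {g : ((K : Type) ≃ₐ[ℚ] (K : Type))} (hg : ∀ x, x ∈ Subgroup.zpowers g) (σ₀ : (K : Type) →+* ℂ) (a b : Fin 14)
    (hab : a ≠ b ∧ Γ.mul Γ.conj a ≠ b) :
    ∃ R : Face K, (∀ k : Fin 14, σ₀.comp ((g ^ (k : ℕ) : ((K : Type) ≃ₐ[ℚ] (K : Type))) : (K : Type) →+* (K : Type)) ∈ R.Φ.1 ↔ (k : ℕ) % 2 = 0) ∧
      R.p = σ₀.comp ((g ^ (a : ℕ) : ((K : Type) ≃ₐ[ℚ] (K : Type))) : (K : Type) →+* (K : Type)) ∧ R.p' = σ₀.comp ((g ^ (b : ℕ) : ((K : Type) ≃ₐ[ℚ] (K : Type))) : (K : Type) →+* (K : Type)) := by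
  obtain ⟨ε, hε, hpow, hconj⟩ := exists_autEnum_of_generator K hK hg σ₀
  obtain ⟨c, hc⟩ := FaceCensus.exists_conjAut σ₀
  obtain ⟨e, hmul, he⟩ := FaceCensus.exists_enum_of_autEnum Γ σ₀ ε hε
  have hconj' : e conjT = Γ.conj := by rw [FaceCensus.conjT_eq_translate σ₀, ← hc, he, hconj c hc]
  obtain ⟨R₀, hT₀, -, -⟩ := FaceCensus.exists_face_reads Γ e hmul hconj' σ₀ (r := (5461, 129, 258)) (by decide +kernel)
  have hne : InfinitePlace.mk (σ₀.comp ((g ^ (a : ℕ) : ((K : Type) ≃ₐ[ℚ] (K : Type))) : (K : Type) →+* (K : Type))) ≠ InfinitePlace.mk (σ₀.comp ((g ^ (b : ℕ) : ((K : Type) ≃ₐ[ℚ] (K : Type))) : (K : Type) →+* (K : Type))) := by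
    rw [Ne, FaceCensus.mk_comp_eq_mk_comp_iff σ₀ hc]
    rintro (h | h)
    · exact hab.1 (by rw [← hpow a, ← hpow b, h])
    · exact hab.2 (by rw [← hpow a, ← hpow b, ← h, hε, hconj c hc])
  refine ⟨⟨R₀.Φ, _, _, hne⟩, fun k => ?_, rfl, rfl⟩
  have hk := hT₀.2 (e (translate σ₀ (σ₀.comp ((g ^ (k : ℕ) : ((K : Type) ≃ₐ[ℚ] (K : Type))) : (K : Type) →+* (K : Type)))))
  rw [e.symm_apply_apply, mem_pullType, translate_apply_self, he, hpow] at hk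
  exact hk.symm.trans (mem_5461_iff k)

/-- **FIELD CLOSURE FROM ONE GENERATOR, type `ℤ/14` (cyclic tetradecic) — CLOSED, headline.**  `K` a Galois CM field of degree `14`
(its Galois group is then cyclic) with a generator `g` of `Aut(K)`; `σ₀` a base embedding; `Φ_{127}`, `Φ_{381}`, `Φ_{5461}` CM types of `K`
reading, on `σ₀ ∘ g ^ k`, as `k < 7`, `k ∈ {0,2,3,4,5,6,8}`, `k` even (they exist: `exists_face_of_generator_*`); the NINE faces
`R₁ = (Φ_{127}; σ₀∘g^0, σ₀∘g^1)`; `R₂ = (Φ_{127}; σ₀∘g^0, σ₀∘g^2)`; `R₃ = (Φ_{127}; σ₀∘g^1, σ₀∘g^4)`; `R₄ = (Φ_{127}; σ₀∘g^1, σ₀∘g^5)`; `R₅ = (Φ_{127}; σ₀∘g^3, σ₀∘g^5)`; `R₆ = (Φ_{127}; σ₀∘g^4, σ₀∘g^5)`; `R₇ = (Φ_{381}; σ₀∘g^2, σ₀∘g^6)`; `R₈ = (Φ_{381}; σ₀∘g^3, σ₀∘g^6)`; `R₉ = (Φ_{5461}; σ₀∘g^0, σ₀∘g^1)` — in lit-andre-3ʼs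 labels the atoms `R₁, R₂, R₃, R₅, R₆, R₄, R₇, R₈, R₀` on `B₀×B₅`, `B₀B₃B₅`, `B₀B₂B₅B₈`, `B₀B₅B₆`,
`B₀B₁B₅B₆`, `B₀B₂B₃B₅`, `B₂B₃B₄B₅`, `B₃B₅B₆B₇`, `E×B₆×B₇`.  ONE period witness for each on the universe of record implies the Hodge
conjecture, in every codimension, for every complex abelian variety dominated by a finite product of abelian varieties realising CM
types of CM fields embeddable in `K` (products of powers of the CM elliptic curve `E` of `k ⊂ K` and of the nine simple CM sevenfolds
split by `K`).  No enumeration, table or conjugation hypothesis is left: the dictionary is `exists_autEnum_of_generator`.  (FRAMING: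
conditional on these nine face periods — `μ(ℤ/14) = 9` is minimal by lit-andre-3ʼs `TetradecicCyclicSpecies.nine_le_card_of_generates`;
`HC_CM` is NOT proved.) [cite: Shimura1998, §6.2 Theorem 3 and §6.1 Corollary of Theorem 2 (pp. 41–43)] [cite: Pohlmann1968, Thm. 1]
[cite: Milne1999LefschetzClasses, Thm. 3.2 and Cor. 4.5] [cite: MumfordAV1970, §19 Thm. 1 and p. 169] -/
theorem hodgeConjectureFor_of_avDominatedBy_isProductOf_of_facePeriod_tetradecicCyclic_gen (K : CMField) [IsGalois ℚ K]
    (hK : Module.finrank ℚ (K : Type) = 14) {g : ((K : Type) ≃ₐ[ℚ] (K : Type))} (hg : ∀ x, x ∈ Subgroup.zpowers g)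
    (σ₀ : (K : Type) →+* ℂ) (R₁ R₂ R₃ R₄ R₅ R₆ R₇ R₈ R₉ : Face K)
    (hΦ₁ : ∀ k : Fin 14, σ₀.comp ((g ^ (k : ℕ) : ((K : Type) ≃ₐ[ℚ] (K : Type))) : (K : Type) →+* (K : Type)) ∈ R₁.Φ.1 ↔ (k : ℕ) < 7)
    (hp₁ : R₁.p = σ₀.comp ((g ^ (0 : ℕ) : ((K : Type) ≃ₐ[ℚ] (K : Type))) : (K : Type) →+* (K : Type))) (hq₁ : R₁.p' = σ₀.comp ((g ^ (1 : ℕ) : ((K : Type) ≃ₐ[ℚ] (K : Type))) : (K : Type) →+* (K : Type)))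
    (hΦ₂ : ∀ k : Fin 14, σ₀.comp ((g ^ (k : ℕ) : ((K : Type) ≃ₐ[ℚ] (K : Type))) : (K : Type) →+* (K : Type)) ∈ R₂.Φ.1 ↔ (k : ℕ) < 7)
    (hp₂ : R₂.p = σ₀.comp ((g ^ (0 : ℕ) : ((K : Type) ≃ₐ[ℚ] (K : Type))) : (K : Type) →+* (K : Type))) (hq₂ : R₂.p' = σ₀.comp ((g ^ (2 : ℕ) : ((K : Type) ≃ₐ[ℚ] (K : Type))) : (K : Type) →+* (K : Type)))
    (hΦ₃ : ∀ k : Fin 14, σ₀.comp ((g ^ (k : ℕ) : ((K : Type) ≃ₐ[ℚ] (K : Type))) : (K : Type) →+* (K : Type)) ∈ R₃.Φ.1 ↔ (k : ℕ) < 7)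
    (hp₃ : R₃.p = σ₀.comp ((g ^ (1 : ℕ) : ((K : Type) ≃ₐ[ℚ] (K : Type))) : (K : Type) →+* (K : Type))) (hq₃ : R₃.p' = σ₀.comp ((g ^ (4 : ℕ) : ((K : Type) ≃ₐ[ℚ] (K : Type))) : (K : Type) →+* (K : Type)))
    (hΦ₄ : ∀ k : Fin 14, σ₀.comp ((g ^ (k : ℕ) : ((K : Type) ≃ₐ[ℚ] (K : Type))) : (K : Type) →+* (K : Type)) ∈ R₄.Φ.1 ↔ (k : ℕ) < 7)
    (hp₄ : R₄.p = σ₀.comp ((g ^ (1 : ℕ) : ((K : Type) ≃ₐ[ℚ] (K : Type))) : (K : Type) →+* (K : Type))) (hq₄ : R₄.p' = σ₀.comp ((g ^ (5 : ℕ) : ((K : Type) ≃ₐ[ℚ] (K : Type))) : (K : Type) →+* (K : Type)))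
    (hΦ₅ : ∀ k : Fin 14, σ₀.comp ((g ^ (k : ℕ) : ((K : Type) ≃ₐ[ℚ] (K : Type))) : (K : Type) →+* (K : Type)) ∈ R₅.Φ.1 ↔ (k : ℕ) < 7)
    (hp₅ : R₅.p = σ₀.comp ((g ^ (3 : ℕ) : ((K : Type) ≃ₐ[ℚ] (K : Type))) : (K : Type) →+* (K : Type))) (hq₅ : R₅.p' = σ₀.comp ((g ^ (5 : ℕ) : ((K : Type) ≃ₐ[ℚ] (K : Type))) : (K : Type) →+* (K : Type)))
    (hΦ₆ : ∀ k : Fin 14, σ₀.comp ((g ^ (k : ℕ) : ((K : Type) ≃ₐ[ℚ] (K : Type))) : (K : Type) →+* (K : Type)) ∈ R₆.Φ.1 ↔ (k : ℕ) < 7)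
    (hp₆ : R₆.p = σ₀.comp ((g ^ (4 : ℕ) : ((K : Type) ≃ₐ[ℚ] (K : Type))) : (K : Type) →+* (K : Type))) (hq₆ : R₆.p' = σ₀.comp ((g ^ (5 : ℕ) : ((K : Type) ≃ₐ[ℚ] (K : Type))) : (K : Type) →+* (K : Type)))
    (hΦ₇ : ∀ k : Fin 14, σ₀.comp ((g ^ (k : ℕ) : ((K : Type) ≃ₐ[ℚ] (K : Type))) : (K : Type) →+* (K : Type)) ∈ R₇.Φ.1 ↔ k ∈ ({0, 2, 3, 4, 5, 6, 8} : Finset (Fin 14)))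
    (hp₇ : R₇.p = σ₀.comp ((g ^ (2 : ℕ) : ((K : Type) ≃ₐ[ℚ] (K : Type))) : (K : Type) →+* (K : Type))) (hq₇ : R₇.p' = σ₀.comp ((g ^ (6 : ℕ) : ((K : Type) ≃ₐ[ℚ] (K : Type))) : (K : Type) →+* (K : Type)))
    (hΦ₈ : ∀ k : Fin 14, σ₀.comp ((g ^ (k : ℕ) : ((K : Type) ≃ₐ[ℚ] (K : Type))) : (K : Type) →+* (K : Type)) ∈ R₈.Φ.1 ↔ k ∈ ({0, 2, 3, 4, 5, 6, 8} : Finset (Fin 14)))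
    (hp₈ : R₈.p = σ₀.comp ((g ^ (3 : ℕ) : ((K : Type) ≃ₐ[ℚ] (K : Type))) : (K : Type) →+* (K : Type))) (hq₈ : R₈.p' = σ₀.comp ((g ^ (6 : ℕ) : ((K : Type) ≃ₐ[ℚ] (K : Type))) : (K : Type) →+* (K : Type)))
    (hΦ₉ : ∀ k : Fin 14, σ₀.comp ((g ^ (k : ℕ) : ((K : Type) ≃ₐ[ℚ] (K : Type))) : (K : Type) →+* (K : Type)) ∈ R₉.Φ.1 ↔ (k : ℕ) % 2 = 0)
    (hp₉ : R₉.p = σ₀.comp ((g ^ (0 : ℕ) : ((K : Type) ≃ₐ[ℚ] (K : Type))) : (K : Type) →+* (K : Type))) (hq₉ : R₉.p' = σ₀.comp ((g ^ (1 : ℕ) : ((K : Type) ≃ₐ[ℚ] (K : Type))) : (K : Type) →+* (K : Type)))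
    (h₁ : ∃ ι₁ : K →+* ℂ, R₁.Admissible ι₁ ∧ ∃ (V : HermSpace3 K ι₁) (σ : K →+* ℂ),
      (Model.picardCMUniverse exists_isReal_hodgeModel_holds hodgePQ_independent_of_hodgeModel_holds
        BallQuotient.ballQuotientUniformised_holds cmAbelianVarietyRealised_holds).PeriodNV ι₁ V K R₁.psi σ)
    (h₂ : ∃ ι₁ : K →+* ℂ, R₂.Admissible ι₁ ∧ ∃ (V : HermSpace3 K ι₁) (σ : K →+* ℂ),
      (Model.picardCMUniverse exists_isReal_hodgeModel_holds hodgePQ_independent_of_hodgeModel_holds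
        BallQuotient.ballQuotientUniformised_holds cmAbelianVarietyRealised_holds).PeriodNV ι₁ V K R₂.psi σ)
    (h₃ : ∃ ι₁ : K →+* ℂ, R₃.Admissible ι₁ ∧ ∃ (V : HermSpace3 K ι₁) (σ : K →+* ℂ),
      (Model.picardCMUniverse exists_isReal_hodgeModel_holds hodgePQ_independent_of_hodgeModel_holds
        BallQuotient.ballQuotientUniformised_holds cmAbelianVarietyRealised_holds).PeriodNV ι₁ V K R₃.psi σ)
    (h₄ : ∃ ι₁ : K →+* ℂ, R₄.Admissible ι₁ ∧ ∃ (V : HermSpace3 K ι₁) (σ : K →+* ℂ),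
      (Model.picardCMUniverse exists_isReal_hodgeModel_holds hodgePQ_independent_of_hodgeModel_holds
        BallQuotient.ballQuotientUniformised_holds cmAbelianVarietyRealised_holds).PeriodNV ι₁ V K R₄.psi σ)
    (h₅ : ∃ ι₁ : K →+* ℂ, R₅.Admissible ι₁ ∧ ∃ (V : HermSpace3 K ι₁) (σ : K →+* ℂ),
      (Model.picardCMUniverse exists_isReal_hodgeModel_holds hodgePQ_independent_of_hodgeModel_holds
        BallQuotient.ballQuotientUniformised_holds cmAbelianVarietyRealised_holds).PeriodNV ι₁ V K R₅.psi σ)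
    (h₆ : ∃ ι₁ : K →+* ℂ, R₆.Admissible ι₁ ∧ ∃ (V : HermSpace3 K ι₁) (σ : K →+* ℂ),
      (Model.picardCMUniverse exists_isReal_hodgeModel_holds hodgePQ_independent_of_hodgeModel_holds
        BallQuotient.ballQuotientUniformised_holds cmAbelianVarietyRealised_holds).PeriodNV ι₁ V K R₆.psi σ)
    (h₇ : ∃ ι₁ : K →+* ℂ, R₇.Admissible ι₁ ∧ ∃ (V : HermSpace3 K ι₁) (σ : K →+* ℂ),
      (Model.picardCMUniverse exists_isReal_hodgeModel_holds hodgePQ_independent_of_hodgeModel_holds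
        BallQuotient.ballQuotientUniformised_holds cmAbelianVarietyRealised_holds).PeriodNV ι₁ V K R₇.psi σ)
    (h₈ : ∃ ι₁ : K →+* ℂ, R₈.Admissible ι₁ ∧ ∃ (V : HermSpace3 K ι₁) (σ : K →+* ℂ),
      (Model.picardCMUniverse exists_isReal_hodgeModel_holds hodgePQ_independent_of_hodgeModel_holds
        BallQuotient.ballQuotientUniformised_holds cmAbelianVarietyRealised_holds).PeriodNV ι₁ V K R₈.psi σ)
    (h₉ : ∃ ι₁ : K →+* ℂ, R₉.Admissible ι₁ ∧ ∃ (V : HermSpace3 K ι₁) (σ : K →+* ℂ),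
      (Model.picardCMUniverse exists_isReal_hodgeModel_holds hodgePQ_independent_of_hodgeModel_holds
        BallQuotient.ballQuotientUniformised_holds cmAbelianVarietyRealised_holds).PeriodNV ι₁ V K R₉.psi σ)
    {P A : AbelianVariety ℂ} (hP : AbelianVariety.IsProductOf (fun B : AbelianVariety ℂ =>
      ∃ (E : Type) (_ : Field E) (_ : NumberField E) (_ : IsCMField E) (_ : E →+* (K : Type)) (Φ : CMType E)
        (ι : 𝓞 E →+* End B) (θ : E →+* Module.End ℂ (complexBetti B.X 1)),
        IsCMTypeRealisation Φ B ι θ) P)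
    (hA : AVDominatedBy A P) : HodgeConjectureFor A.dim A.X := by
  have hn : Nat.card ((K : Type) ≃ₐ[ℚ] (K : Type)) = 14 := (IsGalois.card_aut_eq_finrank ℚ (K : Type)).trans hK
  obtain ⟨ε, hε, hpow, hconj⟩ := exists_autEnum_of_generator K hK hg σ₀
  obtain ⟨c, hc⟩ := FaceCensus.exists_conjAut σ₀
  refine hodgeConjectureFor_of_avDominatedBy_isProductOf_of_facePeriod_tetradecicCyclic_aut K σ₀ ε hε c hc (hconj c hc) R₁ R₂ R₃ R₄ R₅ R₆ R₇ R₈ R₉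
    (g ^ (0 : ℕ)) (g ^ (1 : ℕ)) (g ^ (0 : ℕ)) (g ^ (2 : ℕ)) (g ^ (1 : ℕ)) (g ^ (4 : ℕ)) (g ^ (1 : ℕ)) (g ^ (5 : ℕ)) (g ^ (3 : ℕ)) (g ^ (5 : ℕ)) (g ^ (4 : ℕ)) (g ^ (5 : ℕ)) (g ^ (2 : ℕ)) (g ^ (6 : ℕ)) (g ^ (3 : ℕ)) (g ^ (6 : ℕ)) (g ^ (0 : ℕ)) (g ^ (1 : ℕ))
    ?_ ?_ ?_ ?_ ?_ ?_ ?_ ?_ ?_ ?_ ?_ ?_ ?_ ?_ ?_ ?_ ?_ ?_ ?_ ?_ ?_ ?_ ?_ ?_ ?_ ?_ ?_ ?_ ?_ ?_ ?_ ?_ ?_ ?_ ?_ ?_ ?_ ?_ ?_ ?_ ?_ ?_ ?_ ?_ ?_ h₁ h₂ h₃ h₄ h₅ h₆ h₇ h₈ h₉ hP hA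
  · intro x
    obtain ⟨k, rfl⟩ := FaceCensus.exists_pow_eq_of_generator hg hn x
    rw [hpow, mem_127_iff]
    exact hΦ₁ k
  · exact hp₁
  · rw [show (0 : ℕ) = ((0 : Fin 14) : ℕ) from rfl, hpow]; decide
  · exact hq₁
  · rw [show (1 : ℕ) = ((1 : Fin 14) : ℕ) from rfl, hpow]; decide
  · intro x
    obtain ⟨k, rfl⟩ := FaceCensus.exists_pow_eq_of_generator hg hn x
    rw [hpow, mem_127_iff]
    exact hΦ₂ k
  · exact hp₂
  · rw [show (0 : ℕ) = ((0 : Fin 14) : ℕ) from rfl, hpow]; decide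
  · exact hq₂
  · rw [show (2 : ℕ) = ((2 : Fin 14) : ℕ) from rfl, hpow]; decide
  · intro x
    obtain ⟨k, rfl⟩ := FaceCensus.exists_pow_eq_of_generator hg hn x
    rw [hpow, mem_127_iff]
    exact hΦ₃ k
  · exact hp₃
  · rw [show (1 : ℕ) = ((1 : Fin 14) : ℕ) from rfl, hpow]; decide
  · exact hq₃
  · rw [show (4 : ℕ) = ((4 : Fin 14) : ℕ) from rfl, hpow]; decide
  · intro x
    obtain ⟨k, rfl⟩ := FaceCensus.exists_pow_eq_of_generator hg hn x
    rw [hpow, mem_127_iff]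
    exact hΦ₄ k
  · exact hp₄
  · rw [show (1 : ℕ) = ((1 : Fin 14) : ℕ) from rfl, hpow]; decide
  · exact hq₄
  · rw [show (5 : ℕ) = ((5 : Fin 14) : ℕ) from rfl, hpow]; decide
  · intro x
    obtain ⟨k, rfl⟩ := FaceCensus.exists_pow_eq_of_generator hg hn x
    rw [hpow, mem_127_iff]
    exact hΦ₅ k
  · exact hp₅
  · rw [show (3 : ℕ) = ((3 : Fin 14) : ℕ) from rfl, hpow]; decide
  · exact hq₅
  · rw [show (5 : ℕ) = ((5 : Fin 14) : ℕ) from rfl, hpow]; decide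
  · intro x
    obtain ⟨k, rfl⟩ := FaceCensus.exists_pow_eq_of_generator hg hn x
    rw [hpow, mem_127_iff]
    exact hΦ₆ k
  · exact hp₆
  · rw [show (4 : ℕ) = ((4 : Fin 14) : ℕ) from rfl, hpow]; decide
  · exact hq₆
  · rw [show (5 : ℕ) = ((5 : Fin 14) : ℕ) from rfl, hpow]; decide
  · intro x
    obtain ⟨k, rfl⟩ := FaceCensus.exists_pow_eq_of_generator hg hn x
    rw [hpow, mem_381_iff]
    exact hΦ₇ k
  · exact hp₇
  · rw [show (2 : ℕ) = ((2 : Fin 14) : ℕ) from rfl, hpow]; decide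
  · exact hq₇
  · rw [show (6 : ℕ) = ((6 : Fin 14) : ℕ) from rfl, hpow]; decide
  · intro x
    obtain ⟨k, rfl⟩ := FaceCensus.exists_pow_eq_of_generator hg hn x
    rw [hpow, mem_381_iff]
    exact hΦ₈ k
  · exact hp₈
  · rw [show (3 : ℕ) = ((3 : Fin 14) : ℕ) from rfl, hpow]; decide
  · exact hq₈
  · rw [show (6 : ℕ) = ((6 : Fin 14) : ℕ) from rfl, hpow]; decide
  · intro x
    obtain ⟨k, rfl⟩ := FaceCensus.exists_pow_eq_of_generator hg hn x
    rw [hpow, mem_5461_iff]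
    exact hΦ₉ k
  · exact hp₉
  · rw [show (0 : ℕ) = ((0 : Fin 14) : ℕ) from rfl, hpow]; decide
  · exact hq₉
  · rw [show (1 : ℕ) = ((1 : Fin 14) : ℕ) from rfl, hpow]; decide

end Summit.HodgeConjecture.CorCM.TetradecicFaceTransport.Cyclic

end
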